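import Literature.NumberTheory.LFunctions.FordLemma66
import Mathlib.NumberTheory.Bertrand
import HarnessLib

/-!
# Ford's Lemma 6.7: the iteration `J_{nk,k} → J_{(n+1)k,k}` by induction on `P`

Topic `Literature/NumberTheory/LFunctions`.  Everything in this file is PROVED; no definition and
no named fact is introduced.

K. Ford, *Vinogradov's integral and bounds for the Riemann zeta function*, Proc. LMS 85 (2002),
Lemma 6.7: suppose `J_{s,k}([1,P]) ≤ C P^{2s-k(k+1)/2+Δ}` (`P ≥ 1`), suppose `1 < η ≤ 2` and that
every `x ≥ U` has a prime in `[x, ηx]`; then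
`J_{s+k,k}([1,P]) ≤ C' P^{2(s+k)-k(k+1)/2+Δ'}` (`P ≥ 1`), `Δ' = (1-1/k)Δ`,
`C' = C · max[U^Δ, F η^{k²-Δ}]`,
proved by induction on `P`: for `P < U^k` trivially (`J_{s+k} ≤ P^{2k} J_s`, costing `U^Δ`), and for
`P ≥ U^k` by Lemma 6.6 (`FordVK.ford_lemma66_Icc`) with a prime `P^{1/k} ≤ p ≤ ηP^{1/k}`: the
second-class branch reproduces `C'` (this is where keeping the number of variables pays), the
first-class branch costs `F η^{k²-Δ}`.

We prove it in the tree's constants (`F = 8·2^k·k!·C(k+s,k)²` in place of Ford's `(32/k!)(s+k)^{2k}`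
— the tree's Linnik lemma carries `k! mᵏ`, `m = 2`), with the prime window as an explicit
HYPOTHESIS `hprime` (so that any explicit prime-gap input can be plugged in; Bertrand's postulate,
`η = 2`, is in Mathlib: `FordVK.ford_lemma67_bertrand`), and with the two side conditions on `U`
spelled out (`hU1`: the second-class branch closes, Ford's definition of `U`; `hU2`: the rounding
`P₁ = ⌊P/p⌋ + 1 ≤ (P/p)(1 + p/P)` costs at most a factor `2`).

## Main statements

* `FordVK.ford_lemma67` : Ford's Lemma 6.7 (prime window as a hypothesis).
* `FordVK.ford_lemma67_bertrand` : the case `η = 2` (Bertrand's postulate, unconditional).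

## References

* K. Ford, *Vinogradov's integral and bounds for the Riemann zeta function*, Proc. London Math.
  Soc. (3) 85 (2002), 565–633; arXiv:1910.08209. Lemma 6.7 and its proof. [Ford2002]
-/

noncomputable section

open Finset Real

namespace Literature.NumberTheory.LFunctions
namespace FordVK

open VMV

/-! ### Elementary inequalities -/

/-- `(1 + y)^a ≤ e^{a y}` for `y, a ≥ 0`. [folklore] -/
theorem one_add_rpow_le_exp {y a : ℝ} (hy : 0 ≤ y) (ha : 0 ≤ a) :
    (1 + y) ^ a ≤ Real.exp (a * y) := by
  have h1 : 0 < 1 + y := by linarith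
  rw [Real.rpow_def_of_pos h1]
  apply Real.exp_le_exp.2
  have h2 := Real.log_le_sub_one_of_pos h1
  calc Real.log (1 + y) * a ≤ y * a := mul_le_mul_of_nonneg_right (by linarith) ha
    _ = a * y := mul_comm _ _

/-- `2 · (k(k-1)/2) = k(k-1)` in `ℕ` (the exponent of Linnik's lemma), cast to `ℝ`. [folklore] -/
theorem cast_mul_pred_div_two (k : ℕ) :
    ((k * (k - 1) / 2 : ℕ) : ℝ) = (k : ℝ) * ((k : ℝ) - 1) / 2 := by
  rcases Nat.eq_zero_or_pos k with rfl | hk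
  · simp
  have h := Nat.two_mul_div_two_of_even (Nat.even_mul_pred_self k)
  have h' : ((2 * (k * (k - 1) / 2) : ℕ) : ℝ) = ((k * (k - 1) : ℕ) : ℝ) := by rw [h]
  push_cast [Nat.cast_sub hk] at h'
  linarith

/-! ### Lemma 6.7 -/

set_option maxHeartbeats 1600000 in
/-- **Ford's Lemma 6.7** (iteration keeping the constant in the second-class branch), with the
prime window `[x, ηx]` (`x ≥ U`) as a hypothesis and in the tree's constants.  Let `k ≥ 2`,
`k(k+1)/2 ≤ 2s`, `0 ≤ Δ ≤ k²`, `1 ≤ η ≤ 2`, `U ≥ k + 1`,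
`8 k^{2k+2s} ≤ U^{2s+2-k(k+1)/2+Δ(1-1/k)}` and `4(2(s+k) - k(k+1)/2 + Δ(1-1/k)) ≤ U^{k-1}`.
If `J_{s,k}([1,P]) ≤ C P^{2s-k(k+1)/2+Δ}` for all `P ≥ 1`, then for all `P ≥ 1`
`J_{s+k,k}([1,P]) ≤ C · max(U^Δ, 8·2^k·k!·C(k+s,k)²·η^{k²-Δ}) · P^{2(s+k)-k(k+1)/2+Δ(1-1/k)}`.
[cite: Ford2002, Lemma 6.7 (there `C' = C max[U^Δ, (32/k!)(s+k)^{2k} η^{k²-Δ}]`)] -/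
theorem ford_lemma67 {k s : ℕ} {C Δ η U : ℝ} (hk : 2 ≤ k) (hs2 : (k : ℝ) * (k + 1) / 2 ≤ 2 * s)
    (hC0 : 0 ≤ C) (hΔ0 : 0 ≤ Δ) (hΔ : Δ ≤ (k : ℝ) ^ 2) (hη1 : 1 ≤ η) (hη2 : η ≤ 2)
    (hUk : (k : ℝ) + 1 ≤ U)
    (hU1 : 8 * (k : ℝ) ^ (2 * k + 2 * s)
      ≤ U ^ ((2 * s : ℝ) + 2 - k * (k + 1) / 2 + Δ * (1 - 1 / k)))
    (hU2 : 4 * ((2 * (s + k) : ℝ) - k * (k + 1) / 2 + Δ * (1 - 1 / k)) ≤ U ^ ((k : ℝ) - 1))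
    (hprime : ∀ x : ℝ, U ≤ x → ∃ p : ℕ, p.Prime ∧ x ≤ p ∧ (p : ℝ) ≤ η * x)
    (hJ : ∀ P : ℕ, 1 ≤ P →
      (J k s (Finset.Icc (1 : ℤ) P) : ℝ) ≤ C * (P : ℝ) ^ ((2 * s : ℝ) - k * (k + 1) / 2 + Δ)) :
    ∀ P : ℕ, 1 ≤ P → (J k (k + s) (Finset.Icc (1 : ℤ) P) : ℝ)
      ≤ C * max (U ^ Δ) (8 * 2 ^ k * (Nat.factorial k) * ((k + s).choose k : ℝ) ^ 2
            * η ^ ((k : ℝ) ^ 2 - Δ))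
          * (P : ℝ) ^ ((2 * (s + k) : ℝ) - k * (k + 1) / 2 + Δ * (1 - 1 / k)) := by
  -- abbreviations
  set e : ℝ := (2 * s : ℝ) - k * (k + 1) / 2 + Δ with he_def
  set e' : ℝ := (2 * (s + k) : ℝ) - k * (k + 1) / 2 + Δ * (1 - 1 / k) with he'_def
  set E : ℝ := (2 * s : ℝ) + 2 - k * (k + 1) / 2 + Δ * (1 - 1 / k) with hE_def
  set F : ℝ := 8 * 2 ^ k * (Nat.factorial k) * ((k + s).choose k : ℝ) ^ 2 * η ^ ((k : ℝ) ^ 2 - Δ)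
    with hF_def
  set C' : ℝ := C * max (U ^ Δ) F with hC'_def
  -- sizes
  have hk2 : (2 : ℝ) ≤ k := by exact_mod_cast hk
  have hk0 : (0 : ℝ) < k := by linarith
  have hU3 : (3 : ℝ) ≤ U := by linarith
  have hU0 : 0 < U := by linarith
  have hη0 : 0 < η := by linarith
  have hs1 : 1 ≤ s := by
    have h3 : (3 : ℝ) ≤ 2 * s := le_trans (by nlinarith) hs2
    by_contra h
    push Not at h
    interval_cases s
    norm_num at h3
  have hΔk : Δ / k ≤ k := by
    rw [div_le_iff₀ hk0]; nlinarith
  have hΔk0 : 0 ≤ Δ / k := div_nonneg hΔ0 hk0.le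
  have hee' : e' = e + 2 * k - Δ / k := by
    rw [he_def, he'_def]; field_simp; ring
  have hEe' : E = e' - 2 * k + 2 := by
    rw [hE_def, he'_def]; ring
  have heΔ : Δ ≤ e := by rw [he_def]; linarith
  have he0 : 0 ≤ e := hΔ0.trans heΔ
  have he'0 : 0 ≤ e' := by rw [hee']; nlinarith
  have hke : (k : ℝ) + e ≤ e' := by rw [hee']; linarith
  have hE0 : 0 ≤ E := by
    rw [hEe', hee']
    have : Δ / k ≤ Δ := by
      rw [div_le_iff₀ hk0]; nlinarith
    linarith
  have hF0 : 0 ≤ F := by positivity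
  have hC'U : C * U ^ Δ ≤ C' := mul_le_mul_of_nonneg_left (le_max_left _ _) hC0
  have hC'F : C * F ≤ C' := mul_le_mul_of_nonneg_left (le_max_right _ _) hC0
  have hC'0 : 0 ≤ C' := le_trans (by positivity) hC'U
  -- strong induction on `P`
  intro P
  induction P using Nat.strong_induction_on with
  | _ P ih =>
  intro hP1
  have hP0 : (0 : ℝ) < P := by exact_mod_cast hP1
  by_cases hPU : (P : ℝ) < U ^ k
  · -- the trivial range `P < U^k`
    have h1 : (J k (k + s) (Finset.Icc (1 : ℤ) P) : ℝ)
        ≤ (P : ℝ) ^ (2 * k) * J k s (Finset.Icc (1 : ℤ) P) := by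
      have := J_add_le k k s (Finset.Icc (1 : ℤ) P)
      rw [Int.card_Icc] at this
      have hc : ((P : ℤ) + 1 - 1).toNat = P := by simp
      rw [hc] at this
      exact_mod_cast this
    have h2 := hJ P hP1
    have h4 : (P : ℝ) ^ (2 * k) * (P : ℝ) ^ e = (P : ℝ) ^ e' * (P : ℝ) ^ (Δ / k) := by
      rw [← Real.rpow_natCast, ← Real.rpow_add hP0, ← Real.rpow_add hP0]
      congr 1
      rw [hee']; push_cast; ring
    have h5 : (P : ℝ) ^ (Δ / k) ≤ U ^ Δ := by
      calc (P : ℝ) ^ (Δ / k) ≤ (U ^ k) ^ (Δ / k) :=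
            Real.rpow_le_rpow hP0.le hPU.le hΔk0
        _ = U ^ Δ := by
            rw [← Real.rpow_natCast U k, ← Real.rpow_mul hU0.le]
            congr 1
            field_simp
    calc (J k (k + s) (Finset.Icc (1 : ℤ) P) : ℝ)
          ≤ (P : ℝ) ^ (2 * k) * (C * (P : ℝ) ^ e) :=
          h1.trans (mul_le_mul_of_nonneg_left h2 (by positivity))
      _ = C * (P : ℝ) ^ (Δ / k) * (P : ℝ) ^ e' := by
          rw [show (P : ℝ) ^ (2 * k) * (C * (P : ℝ) ^ e) = C * ((P : ℝ) ^ (2 * k) * (P : ℝ) ^ e) by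
            ring, h4]
          ring
      _ ≤ C * U ^ Δ * (P : ℝ) ^ e' := by gcongr
      _ ≤ C' * (P : ℝ) ^ e' := by gcongr
  · -- the inductive range `P ≥ U^k`
    push Not at hPU
    set x : ℝ := (P : ℝ) ^ ((k : ℝ)⁻¹) with hx_def
    have hx0 : 0 < x := Real.rpow_pos_of_pos hP0 _
    have hxk : x ^ k = (P : ℝ) := by
      rw [hx_def]; exact Real.rpow_inv_natCast_pow hP0.le (by omega)
    have hUx : U ≤ x := by
      have : (U ^ k) ^ ((k : ℝ)⁻¹) ≤ x := Real.rpow_le_rpow (by positivity) hPU (by positivity)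
      rwa [Real.pow_rpow_inv_natCast hU0.le (by omega)] at this
    clear_value x
    obtain ⟨p, hp, hxp, hpx⟩ := hprime x hUx
    have hp0 : (0 : ℝ) < p := by exact_mod_cast hp.pos
    have hUp : U ≤ p := hUx.trans hxp
    have hkp : k < p := by
      have : (k : ℝ) < p := by linarith
      exact_mod_cast this
    have hp2 : 2 ≤ p := hp.two_le
    -- `P ≤ p^k`
    have hPpk_real : (P : ℝ) ≤ (p : ℝ) ^ k := by
      rw [← hxk]; exact pow_le_pow_left₀ hx0.le hxp k
    have hPpk : P ≤ p ^ k := by exact_mod_cast hPpk_real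
    -- `P₁ = ⌊P/p⌋ + 1`
    set P₁ : ℕ := P / p + 1 with hP₁_def
    have hP₁1 : 1 ≤ P₁ := by rw [hP₁_def]; exact Nat.le_add_left 1 _
    have hPP₁ : P ≤ p * P₁ := by
      rw [hP₁_def]
      have := (Nat.lt_mul_div_succ P hp.pos).le
      simpa [mul_comm] using this
    have hm : p * P₁ ≤ 2 * p ^ k := by
      have h1 : p * (P / p) ≤ P := Nat.mul_div_le P p
      have h2 : p ≤ p ^ k := Nat.le_self_pow (by omega) p
      rw [hP₁_def, Nat.mul_add, mul_one]; omega
    have hP9 : 9 ≤ P := by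
      have : (9 : ℝ) ≤ U ^ k := by
        calc (9 : ℝ) = 3 ^ 2 := by norm_num
          _ ≤ U ^ 2 := pow_le_pow_left₀ (by norm_num) hU3 2
          _ ≤ U ^ k := pow_le_pow_right₀ (by linarith) hk
      exact_mod_cast this.trans hPU
    have hP₁lt : P₁ < P := by
      rw [hP₁_def]
      have : P / p ≤ P / 2 := Nat.div_le_div_left hp2 (by norm_num)
      omega
    clear_value P₁
    -- the two inputs
    have hJ1 := ih P₁ hP₁lt hP₁1
    have hJ2 := hJ P₁ hP₁1
    -- `r = p/P` and the rounding factor `(1 + r)^{e'} ≤ 2`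
    set r : ℝ := (p : ℝ) / P with hr_def
    clear_value r
    have hr0 : 0 ≤ r := by rw [hr_def]; positivity
    have hxk1 : U ^ (k - 1) ≤ x ^ (k - 1) := pow_le_pow_left₀ hU0.le hUx _
    have hrx : r ≤ 2 / x ^ (k - 1) := by
      have hq2x : (p : ℝ) ≤ 2 * x := hpx.trans (mul_le_mul_of_nonneg_right hη2 hx0.le)
      rw [hr_def, div_le_div_iff₀ hP0 (by positivity)]
      calc (p : ℝ) * x ^ (k - 1) ≤ 2 * x * x ^ (k - 1) := by gcongr
        _ = 2 * x ^ k := by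
            rw [mul_assoc, ← pow_succ']
            congr 2
            omega
        _ = 2 * P := by rw [hxk]
    have her : e' * r ≤ 1 / 2 := by
      have h1 : e' * r ≤ e' * (2 / U ^ (k - 1)) := by
        apply mul_le_mul_of_nonneg_left _ he'0
        exact hrx.trans (div_le_div_of_nonneg_left (by norm_num) (by positivity) hxk1)
      have h2 : U ^ ((k : ℝ) - 1) = U ^ (k - 1) := by
        rw [← Real.rpow_natCast]
        congr 1
        push_cast [Nat.cast_sub (by omega : 1 ≤ k)]
        ring
      rw [h2] at hU2
      have hUk1 : 0 < U ^ (k - 1) := by positivity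
      calc e' * r ≤ e' * (2 / U ^ (k - 1)) := h1
        _ = (4 * e') / U ^ (k - 1) / 2 := by ring
        _ ≤ U ^ (k - 1) / U ^ (k - 1) / 2 := by gcongr
        _ = 1 / 2 := by rw [div_self hUk1.ne']
    have h1r1 : 1 ≤ 1 + r := le_add_of_nonneg_right hr0
    have h1r0 : 0 < 1 + r := add_pos_of_pos_of_nonneg one_pos hr0
    have exp_half_le_two : Real.exp (1 / 2) ≤ 2 := by
      -- (also `Loewner.ShortTime.exp_half_le_two` elsewhere in the tree; three lines, not worth an import)
      have h : Real.exp (1 / 2) ^ 2 < 2 ^ 2 := by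
        rw [← Real.exp_nat_mul]
        norm_num
        linarith [Real.exp_one_lt_d9]
      exact le_of_lt ((pow_lt_pow_iff_left₀ (Real.exp_pos _).le (by norm_num) two_ne_zero).1 h)
    have h1r : (1 + r) ^ e' ≤ 2 := by
      calc (1 + r) ^ e' ≤ Real.exp (e' * r) := one_add_rpow_le_exp hr0 he'0
        _ ≤ Real.exp (1 / 2) := Real.exp_le_exp.2 her
        _ ≤ 2 := exp_half_le_two
    have h1rke : (1 + r) ^ k * (1 + r) ^ e ≤ 2 := by
      calc (1 + r) ^ k * (1 + r) ^ e = (1 + r) ^ ((k : ℝ) + e) := by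
            rw [← Real.rpow_natCast, ← Real.rpow_add h1r0]
        _ ≤ (1 + r) ^ e' := Real.rpow_le_rpow_of_exponent_le h1r1 hke
        _ ≤ 2 := h1r
    -- `P₁ ≤ (P/p)(1 + r)` and `p P₁ ≤ P (1 + r)`
    have hPq0 : 0 < (P : ℝ) / p := by positivity
    have hP₁le : (P₁ : ℝ) ≤ (P : ℝ) / p * (1 + r) := by
      have h1 : ((P / p : ℕ) : ℝ) ≤ (P : ℝ) / p := Nat.cast_div_le
      have h2 : (P : ℝ) / p * (1 + r) = (P : ℝ) / p + 1 := by
        rw [hr_def]; field_simp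
      rw [h2, hP₁_def]; push_cast
      exact add_le_add h1 le_rfl
    have hP₁0 : (0 : ℝ) ≤ P₁ := by positivity
    have hpP₁le : ((p * P₁ : ℕ) : ℝ) ≤ (P : ℝ) * (1 + r) := by
      have : (P : ℝ) * (1 + r) = p * ((P : ℝ) / p * (1 + r)) := by
        rw [hr_def]; field_simp
      rw [this]; push_cast
      exact mul_le_mul_of_nonneg_left hP₁le hp0.le
    ------------------------------------------------------------------
    -- TERM 1 (second class): `2 (p^{k-1} k^{k+s})² J_{k+s}([1,P₁]) ≤ C' P^{e'} / 2`
    ------------------------------------------------------------------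
    have hT1 : 2 * ((p : ℝ) ^ (k - 1) * (k : ℝ) ^ (k + s)) ^ 2
          * (J k (k + s) (Finset.Icc (1 : ℤ) P₁) : ℝ)
        ≤ C' * (P : ℝ) ^ e' / 2 := by
      have i1 : (P₁ : ℝ) ^ e' ≤ ((P : ℝ) / p) ^ e' * 2 := by
        calc (P₁ : ℝ) ^ e' ≤ ((P : ℝ) / p * (1 + r)) ^ e' := Real.rpow_le_rpow hP₁0 hP₁le he'0
          _ = ((P : ℝ) / p) ^ e' * (1 + r) ^ e' := Real.mul_rpow hPq0.le h1r0.le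
          _ ≤ ((P : ℝ) / p) ^ e' * 2 := by gcongr
      have i2 : ((P : ℝ) / p) ^ e' = (P : ℝ) ^ e' / (p : ℝ) ^ e' := Real.div_rpow hP0.le hp0.le e'
      have i3 : 8 * ((p : ℝ) ^ (k - 1) * (k : ℝ) ^ (k + s)) ^ 2 ≤ (p : ℝ) ^ e' := by
        have j1 : U ^ E ≤ (p : ℝ) ^ E := Real.rpow_le_rpow hU0.le hUp hE0
        have j2 : (p : ℝ) ^ e' = (p : ℝ) ^ E * (p : ℝ) ^ (2 * (k - 1)) := by
          rw [← Real.rpow_natCast (p : ℝ) (2 * (k - 1)), ← Real.rpow_add hp0]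
          congr 1
          rw [hEe']; push_cast [Nat.cast_sub (by omega : 1 ≤ k)]; ring
        calc 8 * ((p : ℝ) ^ (k - 1) * (k : ℝ) ^ (k + s)) ^ 2
            = 8 * (k : ℝ) ^ (2 * k + 2 * s) * (p : ℝ) ^ (2 * (k - 1)) := by
              rw [mul_pow, ← pow_mul, ← pow_mul]
              have : (k + s) * 2 = 2 * k + 2 * s := by ring
              rw [this, mul_comm (k - 1) 2]; ring
          _ ≤ U ^ E * (p : ℝ) ^ (2 * (k - 1)) := by gcongr
          _ ≤ (p : ℝ) ^ E * (p : ℝ) ^ (2 * (k - 1)) := by gcongr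
          _ = (p : ℝ) ^ e' := j2.symm
      have hpe'0 : 0 < (p : ℝ) ^ e' := Real.rpow_pos_of_pos hp0 _
      calc 2 * ((p : ℝ) ^ (k - 1) * (k : ℝ) ^ (k + s)) ^ 2 * (J k (k + s) (Finset.Icc (1 : ℤ) P₁) : ℝ)
          ≤ 2 * ((p : ℝ) ^ (k - 1) * (k : ℝ) ^ (k + s)) ^ 2 * (C' * (P₁ : ℝ) ^ e') := by gcongr
        _ ≤ 2 * ((p : ℝ) ^ (k - 1) * (k : ℝ) ^ (k + s)) ^ 2 * (C' * (((P : ℝ) / p) ^ e' * 2)) := by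
            gcongr
        _ = (8 * ((p : ℝ) ^ (k - 1) * (k : ℝ) ^ (k + s)) ^ 2) * ((P : ℝ) ^ e' / (p : ℝ) ^ e')
              * C' / 2 := by rw [i2]; ring
        _ ≤ (p : ℝ) ^ e' * ((P : ℝ) ^ e' / (p : ℝ) ^ e') * C' / 2 := by gcongr
        _ = C' * (P : ℝ) ^ e' / 2 := by field_simp
    ------------------------------------------------------------------
    -- TERM 2 (first class): `≤ C F P^{e'} / 2`
    ------------------------------------------------------------------
    have hT2 : 2 * (((k + s).choose k : ℕ) : ℝ) ^ 2 * ((p : ℝ) ^ (2 * s) * ((p * P₁ : ℕ) : ℝ) ^ k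
          * ((Nat.factorial k : ℝ) * (2 : ℝ) ^ k * (p : ℝ) ^ (k * (k - 1) / 2)))
          * (J k s (Finset.Icc (1 : ℤ) P₁) : ℝ) ≤ C * F * (P : ℝ) ^ e' / 2 := by
      -- the `p`-powers collect to `p^{k²-Δ} ≤ η^{k²-Δ} P^{k-Δ/k}`
      have hkΔ0 : 0 ≤ (k : ℝ) ^ 2 - Δ := by linarith
      have q1 : (p : ℝ) ^ (2 * s) * (p : ℝ) ^ (k * (k - 1) / 2) / (p : ℝ) ^ e
          = (p : ℝ) ^ ((k : ℝ) ^ 2 - Δ) := by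
        rw [← Real.rpow_natCast (p : ℝ) (2 * s), ← Real.rpow_natCast (p : ℝ) (k * (k - 1) / 2),
          ← Real.rpow_add hp0, ← Real.rpow_sub hp0]
        congr 1
        rw [cast_mul_pred_div_two, he_def]; push_cast; ring
      have q2 : (p : ℝ) ^ ((k : ℝ) ^ 2 - Δ) ≤ η ^ ((k : ℝ) ^ 2 - Δ) * (P : ℝ) ^ ((k : ℝ) - Δ / k) := by
        calc (p : ℝ) ^ ((k : ℝ) ^ 2 - Δ) ≤ (η * x) ^ ((k : ℝ) ^ 2 - Δ) :=
              Real.rpow_le_rpow hp0.le hpx hkΔ0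
          _ = η ^ ((k : ℝ) ^ 2 - Δ) * x ^ ((k : ℝ) ^ 2 - Δ) := Real.mul_rpow hη0.le hx0.le
          _ = η ^ ((k : ℝ) ^ 2 - Δ) * (P : ℝ) ^ ((k : ℝ) - Δ / k) := by
              congr 1
              rw [hx_def, ← Real.rpow_mul hP0.le]
              congr 1
              field_simp
      have q3 : (p : ℝ) ^ (2 * s) * (p : ℝ) ^ (k * (k - 1) / 2) * (((P : ℝ) / p) ^ e)
          ≤ η ^ ((k : ℝ) ^ 2 - Δ) * (P : ℝ) ^ ((k : ℝ) - Δ / k) * (P : ℝ) ^ e := by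
        have hpe0 : 0 < (p : ℝ) ^ e := Real.rpow_pos_of_pos hp0 _
        rw [Real.div_rpow hP0.le hp0.le, show (p : ℝ) ^ (2 * s) * (p : ℝ) ^ (k * (k - 1) / 2)
          * ((P : ℝ) ^ e / (p : ℝ) ^ e) = ((p : ℝ) ^ (2 * s) * (p : ℝ) ^ (k * (k - 1) / 2) / (p : ℝ) ^ e)
          * (P : ℝ) ^ e by field_simp, q1]
        exact mul_le_mul_of_nonneg_right q2 (by positivity)
      -- the `P`-powers collect to `P^{e'}`
      have q4 : (P : ℝ) ^ k * ((P : ℝ) ^ ((k : ℝ) - Δ / k) * (P : ℝ) ^ e) = (P : ℝ) ^ e' := by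
        rw [← Real.rpow_natCast, ← Real.rpow_add hP0, ← Real.rpow_add hP0]
        congr 1
        rw [hee']; ring
      -- inputs
      have i1 : ((p * P₁ : ℕ) : ℝ) ^ k ≤ (P : ℝ) ^ k * (1 + r) ^ k := by
        rw [← mul_pow]; exact pow_le_pow_left₀ (by positivity) hpP₁le k
      have i2 : (J k s (Finset.Icc (1 : ℤ) P₁) : ℝ) ≤ C * ((((P : ℝ) / p) ^ e) * (1 + r) ^ e) := by
        refine hJ2.trans (mul_le_mul_of_nonneg_left ?_ hC0)
        calc (P₁ : ℝ) ^ e ≤ ((P : ℝ) / p * (1 + r)) ^ e := Real.rpow_le_rpow hP₁0 hP₁le he0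
          _ = ((P : ℝ) / p) ^ e * (1 + r) ^ e := Real.mul_rpow hPq0.le h1r0.le
      have hPpe0 : 0 ≤ ((P : ℝ) / p) ^ e := (Real.rpow_pos_of_pos hPq0 _).le
      calc 2 * (((k + s).choose k : ℕ) : ℝ) ^ 2 * ((p : ℝ) ^ (2 * s) * ((p * P₁ : ℕ) : ℝ) ^ k
            * ((Nat.factorial k : ℝ) * (2 : ℝ) ^ k * (p : ℝ) ^ (k * (k - 1) / 2)))
            * (J k s (Finset.Icc (1 : ℤ) P₁) : ℝ)
          ≤ 2 * (((k + s).choose k : ℕ) : ℝ) ^ 2 * ((p : ℝ) ^ (2 * s) * ((P : ℝ) ^ k * (1 + r) ^ k)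
            * ((Nat.factorial k : ℝ) * (2 : ℝ) ^ k * (p : ℝ) ^ (k * (k - 1) / 2)))
            * (C * ((((P : ℝ) / p) ^ e) * (1 + r) ^ e)) := by gcongr
        _ = (2 * (((k + s).choose k : ℕ) : ℝ) ^ 2 * (Nat.factorial k : ℝ) * (2 : ℝ) ^ k * C)
            * ((p : ℝ) ^ (2 * s) * (p : ℝ) ^ (k * (k - 1) / 2) * (((P : ℝ) / p) ^ e))
            * (P : ℝ) ^ k * ((1 + r) ^ k * (1 + r) ^ e) := by ring
        _ ≤ (2 * (((k + s).choose k : ℕ) : ℝ) ^ 2 * (Nat.factorial k : ℝ) * (2 : ℝ) ^ k * C)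
            * (η ^ ((k : ℝ) ^ 2 - Δ) * (P : ℝ) ^ ((k : ℝ) - Δ / k) * (P : ℝ) ^ e)
            * (P : ℝ) ^ k * 2 := by gcongr
        _ = C * F / 2 * ((P : ℝ) ^ k * ((P : ℝ) ^ ((k : ℝ) - Δ / k) * (P : ℝ) ^ e)) := by
            rw [hF_def]; ring
        _ = C * F * (P : ℝ) ^ e' / 2 := by rw [q4]; ring
    -- conclusion
    have hPe'0 : 0 ≤ (P : ℝ) ^ e' := (Real.rpow_pos_of_pos hP0 _).le
    have h66 := ford_lemma66_Icc (n := k) (s := s) (p := p) (P₁ := P₁) (m := 2) (P := P) hp hkp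
      (one_le_two.trans hk) hs1 hm hPP₁
    simp only [Nat.cast_ofNat] at h66
    calc (J k (k + s) (Finset.Icc (1 : ℤ) P) : ℝ) ≤ _ := h66
      _ ≤ C' * (P : ℝ) ^ e' / 2 + C * F * (P : ℝ) ^ e' / 2 := add_le_add hT1 hT2
      _ ≤ C' * (P : ℝ) ^ e' / 2 + C' * (P : ℝ) ^ e' / 2 := by gcongr
      _ = C' * (P : ℝ) ^ e' := by ring

/-- **Lemma 6.7 with Bertrand's postulate** (`η = 2`, unconditional): the prime window
hypothesis of `ford_lemma67` is discharged by `Nat.exists_prime_lt_and_le_two_mul`.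
[cite: Ford2002, Lemma 6.7 (η = 2)] -/
theorem ford_lemma67_bertrand {k s : ℕ} {C Δ U : ℝ} (hk : 2 ≤ k)
    (hs2 : (k : ℝ) * (k + 1) / 2 ≤ 2 * s)
    (hC0 : 0 ≤ C) (hΔ0 : 0 ≤ Δ) (hΔ : Δ ≤ (k : ℝ) ^ 2) (hUk : (k : ℝ) + 1 ≤ U)
    (hU1 : 8 * (k : ℝ) ^ (2 * k + 2 * s)
      ≤ U ^ ((2 * s : ℝ) + 2 - k * (k + 1) / 2 + Δ * (1 - 1 / k)))
    (hU2 : 4 * ((2 * (s + k) : ℝ) - k * (k + 1) / 2 + Δ * (1 - 1 / k)) ≤ U ^ ((k : ℝ) - 1))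
    (hJ : ∀ P : ℕ, 1 ≤ P →
      (J k s (Finset.Icc (1 : ℤ) P) : ℝ) ≤ C * (P : ℝ) ^ ((2 * s : ℝ) - k * (k + 1) / 2 + Δ)) :
    ∀ P : ℕ, 1 ≤ P → (J k (k + s) (Finset.Icc (1 : ℤ) P) : ℝ)
      ≤ C * max (U ^ Δ) (8 * 2 ^ k * (Nat.factorial k) * ((k + s).choose k : ℝ) ^ 2
            * (2 : ℝ) ^ ((k : ℝ) ^ 2 - Δ))
          * (P : ℝ) ^ ((2 * (s + k) : ℝ) - k * (k + 1) / 2 + Δ * (1 - 1 / k)) := by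
  refine ford_lemma67 hk hs2 hC0 hΔ0 hΔ (by norm_num) le_rfl hUk hU1 hU2 ?_ hJ
  intro x hx
  have hx1 : 1 ≤ x := by
    have : (2 : ℝ) ≤ k := by exact_mod_cast hk
    linarith
  -- Bertrand at `n = ⌊x⌋ ≥ 1`: a prime `q` with `x < ⌊x⌋ + 1 ≤ q ≤ 2⌊x⌋ ≤ 2x`.
  have hfl : 1 ≤ ⌊x⌋₊ := Nat.one_le_floor_iff x |>.2 hx1
  obtain ⟨q, hq, hq1, hq2⟩ := Nat.exists_prime_lt_and_le_two_mul ⌊x⌋₊ (by omega)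
  refine ⟨q, hq, ?_, ?_⟩
  · have h1 : x < (⌊x⌋₊ : ℝ) + 1 := Nat.lt_floor_add_one x
    have h2 : (⌊x⌋₊ : ℝ) + 1 ≤ q := by exact_mod_cast hq1
    linarith
  · have h1 : ((q : ℕ) : ℝ) ≤ 2 * (⌊x⌋₊ : ℝ) := by exact_mod_cast hq2
    have h2 : (⌊x⌋₊ : ℝ) ≤ x := Nat.floor_le (by linarith)
    linarith

end FordVK
end Literature.NumberTheory.LFunctions
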